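import Summits.QuantumFields.BalabanUV.Beta.FP.OneShotKKTPolarization

/-!
# `BalabanUV.Beta.FP.OneShotKKTPolarizationLine` — road «FP» for binder row D1, organisation γ, row **GAMMA-0, half (b)**, companion §5 of
# `FP/OneShotKKTPolarization` (split for the ≤ 400-line rule): THE JUNCTION WITH HALF (a) — the diagonal `hessianAt` entry IS the second derivative
# along the coordinate line, so row GAMMA-0's sentence «`W_n″(0)` along `V = t·v` = the six loops with the transported jets» holds in the `HasDerivAt`
# (curve) currency of beta-d1-formalise-leaf-05-g11's `FP/OneShotKKTTorus` as a COROLLARY of the `polarization` ∕ `hessianAt` half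

HONEST DEPENDENCY (page 1, mandatory): continuum YM on T⁴ ⇐ BetaPertH ∧ nine spine estimates (0/9 proved); BetaPertH ⇐ (D1) ∧ (D4) ∧ CAP+tail;
G-an2-4 gates asym, D1 and NE2/3/4.  HONEST FRAMING (cell contract, verbatim): «discharging `BetaPertH` makes Bałaban's UV stability UNCONDITIONAL —
a real constructive-QFT result; it is NOT the continuum limit and NOT the Clay problem.»  THIS MODULE DISCHARGES NOTHING of the wall: it is [folklore]
one-variable ∕ Fréchet calculus (Mathlib `HasFDerivAt.comp_hasDerivAt`, `HasFDerivAt.clm_apply`, `iteratedFDeriv_two_apply`) over pv25's `OneLoop.hessianAt`,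
pv16's `FamilyRegularity.Family.contDiffAt_logZ` and `FP/OneShotKKTPolarization.hessianAt_oneShot_diag_eq_sixLoops_kkt_of_tadpoleFree` BY NAME.  No `def`,
no `def … : Prop`, nothing cited, 0 sorry; 0 estimates; 0∕4 row-D1 binders; NOT D1, NOT BetaPertH, NOT continuum, NOT Clay.

ABSOLUTE RULE (cell charter, verbatim): «No internally-minted statement may enter as a cited fact. Every hypothesis is either kernel-proved in this
package or a verbatim quotation of a PUBLISHED theorem with page reference. The manuscript(s) under audit are NOT citable for their own disputed steps —
they are the thing under adjudication; programme-internal (2001/route/tribunal) claims are never citable.»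

CONTENT (all [folklore]):
§5a `eventually_hasDerivAt_line` ∕ `hasDerivAt_fderiv_line` — a `C²` scalar function along an affine line `t ↦ x₀ + t·v`: the first-derivative field
    `t ↦ Df(x₀ + t·v)[v]` exists near `0` and has derivative `D²f(x₀)[v][v]` at `0`; `hessianAt_eq_fderiv_fderiv`; **`hasDerivAt_line_hessianAt`** —
    `hessianAt f i i` IS the derivative at `0` of the first-derivative field of `t ↦ f(t·eᵢ)`.
§5b `contDiffAt_oneShot` (the one shot `Φ =ᶠ log Z ∘ U + Gh + c` is `C²` at `0`); **`hasDerivAt_line_oneShot_of_tadpoleFree`** — THE ROW'S SENTENCE in half (a)'s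
    shape: tadpole-free, along `V = t·eᵢ` the one shot's first-derivative field has derivative
    `−½·secondVar (kkt Δ₀ Q₀) (kkt Ḣᵢ Q̇ᵢ) (kkt Ḧᵢᵢ Q̈ᵢᵢ) + hessianAt Gh i i` at `0` (`Ḣᵢ = Σ_a Jᵢ_a∂_aΔ`, … the transported jets, `J = ∂U(0)`;
    `−½·secondVar …` displays as RHOA-10's `sixLoops_kkt`).
Provenance: cross-cell idle seat b2b-balaban-t4-ne7b-formalise-leaf-09 (gen 20, prover-b2b-balaban-t4-ne7b-formalise-leaf-09-g20-0) for road FP owner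
b2b-balaban-beta-d1-p3, 2026-08-21 (row GAMMA-0 half (b), journal INTENT «GAMMA-0 (b)» l.24470, holder GO l.24499).  [folklore], 0 def, 0 cite, 0 sorry.
-/

noncomputable section

namespace Summit.QuantumFields.BalabanUV.Beta.FP.OneShotKKTPolarizationLine

open Filter Topology Matrix Finset
open scoped BigOperators Matrix
open Literature.MathematicalPhysics.QuantumFieldTheory.Balaban1983to89.Beta (hessianAt Family ConstrainedGaussian)
open Literature.MathematicalPhysics.QuantumFieldTheory.Balaban1983to89.Beta.Composition (kkt)
open Literature.MathematicalPhysics.QuantumFieldTheory.Balaban1983to89.Beta.CompositionSingular (effForm minOp flucCov)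
open Summit.QuantumFields.BalabanUV.Beta.D1BFx.LogDetSecondVariation (secondVar)
open Summit.QuantumFields.BalabanUV.Beta.FP.OneShotKKTPolarization (hessianAt_oneShot_diag_eq_sixLoops_kkt_of_tadpoleFree)

/-! ## §5 Junction with half (a): the diagonal `hessianAt` IS the second derivative along the coordinate line (curve currency) -/

section LineJet

variable {E : Type*} [NormedAddCommGroup E] [NormedSpace ℝ E]

/-- [folklore] **FIRST DERIVATIVE ALONG AN AFFINE LINE, NEAR `0`**: if `f` is `C²` at `x₀` then, for `t` near `0`, `s ↦ f (x₀ + s·v)` has derivative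
`Df(x₀ + t·v)[v]` at `t`. -/
theorem eventually_hasDerivAt_line {f : E → ℝ} {x₀ : E} (hf : ContDiffAt ℝ 2 f x₀) (v : E) :
    ∀ᶠ t in 𝓝 (0 : ℝ), HasDerivAt (fun s : ℝ => f (x₀ + s • v)) (fderiv ℝ f (x₀ + t • v) v) t := by
  have hd : ∀ᶠ y in 𝓝 x₀, DifferentiableAt ℝ f y :=
    (hf.eventually (by simp)).mono fun y hy => hy.differentiableAt two_ne_zero
  have hline : Tendsto (fun t : ℝ => x₀ + t • v) (𝓝 0) (𝓝 x₀) := by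
    have : Continuous (fun t : ℝ => x₀ + t • v) := by continuity
    simpa using this.tendsto 0
  filter_upwards [hline.eventually hd] with t ht
  have hl : HasDerivAt (fun s : ℝ => x₀ + s • v) v t := by
    simpa using ((hasDerivAt_id t).smul_const v).const_add x₀
  exact ht.hasFDerivAt.comp_hasDerivAt t hl

/-- [folklore] **SECOND DERIVATIVE ALONG THE LINE AT `0`**: if `f` is `C²` at `x₀`, the first-derivative field `t ↦ Df(x₀ + t·v)[v]` has derivative
`D²f(x₀)[v][v]` at `t = 0`. -/
theorem hasDerivAt_fderiv_line {f : E → ℝ} {x₀ : E} (hf : ContDiffAt ℝ 2 f x₀) (v : E) :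
    HasDerivAt (fun t : ℝ => fderiv ℝ f (x₀ + t • v) v) (fderiv ℝ (fderiv ℝ f) x₀ v v) 0 := by
  have hdf : DifferentiableAt ℝ (fderiv ℝ f) x₀ :=
    (hf.fderiv_right (m := 1) (by norm_num)).differentiableAt one_ne_zero
  -- the scalar field `y ↦ Df(y)[v]` is differentiable at `x₀` with derivative `w ↦ D²f(x₀)[w][v]`
  have h2 : HasFDerivAt (fun y => fderiv ℝ f y v) ((fderiv ℝ (fderiv ℝ f) x₀).flip v) x₀ := by
    have h := hdf.hasFDerivAt.clm_apply (hasFDerivAt_const v x₀)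
    simpa using h
  have hl : HasDerivAt (fun s : ℝ => x₀ + s • v) v 0 := by
    simpa using ((hasDerivAt_id (0 : ℝ)).smul_const v).const_add x₀
  have h0 : x₀ + (0 : ℝ) • v = x₀ := by simp
  rw [← h0] at h2
  have h := h2.comp_hasDerivAt (0 : ℝ) hl
  rw [h0, ContinuousLinearMap.flip_apply] at h
  exact h

variable {ι : Type*} [Fintype ι] [DecidableEq ι]

/-- [folklore] `hessianAt f i j = D²f(0)[eᵢ][eⱼ]` (pv25's `hessianAt` unfolded by `iteratedFDeriv_two_apply`). -/
theorem hessianAt_eq_fderiv_fderiv (f : (ι → ℝ) → ℝ) (i j : ι) :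
    hessianAt f i j = fderiv ℝ (fderiv ℝ f) 0 (Pi.single i 1) (Pi.single j 1) := by
  simp [hessianAt, iteratedFDeriv_two_apply]

/-- [folklore] **THE DIAGONAL HESSIAN ENTRY IN THE CURVE CURRENCY**: for `f` of class `C²` at `0`, the curve `s ↦ f(s·eᵢ)` has, near `t = 0`, the derivative
`Df(t·eᵢ)[eᵢ]`, and that first-derivative field has derivative `hessianAt f i i` at `0` — the `HasDerivAt` shape of half (a) (`FP/OneShotKKTTorus`). -/
theorem hasDerivAt_line_hessianAt {f : (ι → ℝ) → ℝ} (hf : ContDiffAt ℝ 2 f 0) (i : ι) :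
    (∀ᶠ t in 𝓝 (0 : ℝ), HasDerivAt (fun s : ℝ => f (s • Pi.single i 1)) (fderiv ℝ f (t • Pi.single i 1) (Pi.single i 1)) t)
    ∧ HasDerivAt (fun t : ℝ => fderiv ℝ f (t • Pi.single i 1) (Pi.single i 1)) (hessianAt f i i) 0 := by
  refine ⟨?_, ?_⟩
  · simpa using eventually_hasDerivAt_line hf (Pi.single i 1)
  · rw [hessianAt_eq_fderiv_fderiv]
    simpa using hasDerivAt_fderiv_line hf (Pi.single i 1)

end LineJet

section LineOneShot

variable {ι κ : Type*} [Fintype ι] [DecidableEq ι] [Fintype κ] [DecidableEq κ] {n m : ℕ}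

omit [DecidableEq ι] [DecidableEq κ] in
/-- [folklore] The one-shot functional of `hessianAt_oneShot_eq` is `C²` at `0` (it agrees near `0` with `log Z ∘ U + Gh + c`, all `C²`;
`FamilyRegularity.Family.contDiffAt_logZ` BY NAME). -/
theorem contDiffAt_oneShot (F : Family κ n m) {Φ Gh : (ι → ℝ) → ℝ} {U : (ι → ℝ) → (κ → ℝ)} {c : ℝ}
    (hΦ : Φ =ᶠ[𝓝 0] fun V => F.logZ (U V) + Gh V + c) (hU0 : U 0 = 0) (hU : ContDiffAt ℝ 2 U 0) (hGh : ContDiffAt ℝ 2 Gh 0)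
    (hQ : ∀ a b, ContDiffAt ℝ 2 (fun B => (F B).Q a b) 0) (hΔ : ∀ a b, ContDiffAt ℝ 2 (fun B => (F B).Δ a b) 0)
    (hdet : (F 0).kkt.det ≠ 0) : ContDiffAt ℝ 2 Φ 0 := by
  have hf : ContDiffAt ℝ 2 F.logZ (U 0) := by rw [hU0]; exact F.contDiffAt_logZ hQ hΔ hdet
  exact (((hf.comp 0 hU).add hGh).add contDiffAt_const).congr_of_eventuallyEq hΦ

/-- [folklore] **ROW GAMMA-0's SENTENCE, CURVE CURRENCY, TADPOLE-FREE**: under the hypotheses of `hessianAt_oneShot_diag_eq_sixLoops_kkt_of_tadpoleFree`, the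
one shot ALONG THE COORDINATE LINE `V = t·eᵢ`, `t ↦ Φ(t·eᵢ)` (= `W_n + Gh` along the line, up to the constant), has near `t = 0` the derivative field
`t ↦ DΦ(t·eᵢ)[eᵢ]`, and THAT FIELD HAS DERIVATIVE AT `0` EQUAL TO
`−½·secondVar (kkt Δ₀ Q₀) (kkt Ḣᵢ Q̇ᵢ) (kkt Ḧᵢᵢ Q̈ᵢᵢ) + hessianAt Gh i i` — RHOA-10's `sixLoops_kkt` with the transported jets `Ḣᵢ = Σ_a Jᵢ_a∂_aΔ`, …, plus
the ghost: «`W_n″(0)` along `V = t·v` is the six loops with `H₁ = Ḣ[Jv]`, `Q₁ = Q̇[Jv]`, `H₂, Q₂` the second jets» at `v = eᵢ`, in half (a)'s `HasDerivAt` shape. -/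
theorem hasDerivAt_line_oneShot_of_tadpoleFree (F : Family κ n m) {Φ Gh : (ι → ℝ) → ℝ} {U : (ι → ℝ) → (κ → ℝ)} {c : ℝ}
    (hΦ : Φ =ᶠ[𝓝 0] fun V => F.logZ (U V) + Gh V + c) (hU0 : U 0 = 0) (hU : ContDiffAt ℝ 2 U 0) (hGh : ContDiffAt ℝ 2 Gh 0)
    (hQ : ∀ a b, ContDiffAt ℝ 2 (fun B => (F B).Q a b) 0) (hΔ : ∀ a b, ContDiffAt ℝ 2 (fun B => (F B).Δ a b) 0)
    (hdet : (F 0).kkt.det ≠ 0) (hsymm : ∀ᶠ B in 𝓝 (0 : κ → ℝ), (F B).Δ.IsSymm)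
    (htad : ∀ a, -(1 / 2 : ℝ) * (flucCov (F 0).Δ (F 0).Q * F.dΔ a).trace - (minOp (F 0).Δ (F 0).Q * F.dQ a).trace = 0)
    (i : ι) :
    (∀ᶠ t in 𝓝 (0 : ℝ), HasDerivAt (fun s : ℝ => Φ (s • Pi.single i 1)) (fderiv ℝ Φ (t • Pi.single i 1) (Pi.single i 1)) t)
    ∧ HasDerivAt (fun t : ℝ => fderiv ℝ Φ (t • Pi.single i 1) (Pi.single i 1))
        (-(1 / 2 : ℝ) * secondVar (kkt (F 0).Δ (F 0).Q)
            (kkt (∑ a, fderiv ℝ U 0 (Pi.single i 1) a • F.dΔ a) (∑ a, fderiv ℝ U 0 (Pi.single i 1) a • F.dQ a))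
            (kkt (∑ a, ∑ b, (fderiv ℝ U 0 (Pi.single i 1) a * fderiv ℝ U 0 (Pi.single i 1) b) • F.d2Δ a b)
              (∑ a, ∑ b, (fderiv ℝ U 0 (Pi.single i 1) a * fderiv ℝ U 0 (Pi.single i 1) b) • F.d2Q a b))
          + hessianAt Gh i i) 0 := by
  rw [← hessianAt_oneShot_diag_eq_sixLoops_kkt_of_tadpoleFree F hΦ hU0 hU hGh hQ hΔ hdet hsymm htad i]
  exact hasDerivAt_line_hessianAt (contDiffAt_oneShot F hΦ hU0 hU hGh hQ hΔ hdet) i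

end LineOneShot

end Summit.QuantumFields.BalabanUV.Beta.FP.OneShotKKTPolarizationLine

end
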